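import Summits.CriticalPhenomena.PercolationContinuityZ3.Theorems.PercNearOneGluingNoHeavyQuantFarSunGameLam
import Summits.CriticalPhenomena.PercolationContinuityZ3.Theorems.PercNearOneGluingNoHeavyQuantFarSunGameAvg
import Mathlib.Tactic.Ring
import Mathlib.Tactic.Linarith
import HarnessLib

/-!
# FAR beyond trees: the λ-refined automaton payoff as a pattern expectation, and its comparison with `flankPay − λ·𝟙[#Q ≤ 2]`

builds on p205010 (kernel theorem, internal audit signed; external expert review pending)

Support file (`--supports stmt-CriticalPhenomena-4575`), seat `prim-cert-1` (gen 39); memo §7(a).  `autoEL start (h 0, …) = Σ_Q hairW·payL(run Q)` and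
`payL(run Q) ≤ flankPay K Q − λ·𝟙[#Q ≤ 2]` (`Amax ≥ 5`, `K ≤ Kcred`), so a threshold certificate of …GameLam bounds `Σ_Q hairW·flankPay − λ·(1 − hairV K h 2 (range K))`
from below at every certified word.  Elementary [this work]; no sorries; standard axioms.
-/

noncomputable section

namespace Summit.CriticalPhenomena.PercolationContinuityZ3.Theorems.HairyCycle

open Finset

variable {K : ℕ}

/-- **`autoEL` over a block of positions is a pattern expectation** (general suffix form). [this work] -/
theorem autoEL_range' (Amax C Cc Kcred lamN lamD : ℕ) (h : ℕ → ℝ) :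
    ∀ (n m : ℕ) (s : FSt), autoEL Amax C Cc Kcred lamN lamD s ((List.range' m n).map h) =
      ∑ Q ∈ (Finset.Ico m (m + n)).powerset, prodW (Finset.Ico m (m + n)) h Q * (FSt.runI Amax C Cc Q s m n).payL Amax Kcred lamN lamD := by
  intro n
  induction n with
  | zero =>
    intro m s
    simp only [List.range'_zero, List.map_nil, Nat.add_zero, Finset.Ico_self, Finset.powerset_empty, Finset.sum_singleton]
    unfold prodW FSt.runI
    simp [autoEL]
  | succ n ih =>
    intro m s
    rw [List.range'_succ, List.map_cons]
    change h m * autoEL Amax C Cc Kcred lamN lamD (s.op Amax Cc) ((List.range' (m + 1) n).map h) +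
        (1 - h m) * autoEL Amax C Cc Kcred lamN lamD (s.cl C) ((List.range' (m + 1) n).map h) = _
    rw [ih (m + 1) (s.op Amax Cc), ih (m + 1) (s.cl C)]
    have hS : Finset.Ico m (m + (n + 1)) = insert m (Finset.Ico (m + 1) (m + 1 + n)) := by
      rw [show m + 1 + n = m + (n + 1) by omega]
      exact (Finset.insert_Ico_add_one_left_eq_Ico (by omega)).symm
    have hmS : m ∉ Finset.Ico (m + 1) (m + 1 + n) := by simp
    rw [hS, Finset.sum_powerset_insert hmS]
    -- patterns without `m` (closed at `m`) and with `m` (open at `m`)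
    have hcl : ∀ Q ∈ (Finset.Ico (m + 1) (m + 1 + n)).powerset,
        prodW (insert m (Finset.Ico (m + 1) (m + 1 + n))) h Q * (FSt.runI Amax C Cc Q s m (n + 1)).payL Amax Kcred lamN lamD =
          (1 - h m) * (prodW (Finset.Ico (m + 1) (m + 1 + n)) h Q * (FSt.runI Amax C Cc Q (s.cl C) (m + 1) n).payL Amax Kcred lamN lamD) := by
      intro Q hQ
      rw [Finset.mem_powerset] at hQ
      have hmQ : m ∉ Q := fun hm => hmS (hQ hm)
      unfold prodW
      rw [Finset.prod_insert hmS, if_neg hmQ, runI_succ_not_mem s n hmQ]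
      ring
    have hop : ∀ Q ∈ (Finset.Ico (m + 1) (m + 1 + n)).powerset,
        prodW (insert m (Finset.Ico (m + 1) (m + 1 + n))) h (insert m Q) * (FSt.runI Amax C Cc (insert m Q) s m (n + 1)).payL Amax Kcred lamN lamD =
          h m * (prodW (Finset.Ico (m + 1) (m + 1 + n)) h Q * (FSt.runI Amax C Cc Q (s.op Amax Cc) (m + 1) n).payL Amax Kcred lamN lamD) := by
      intro Q _
      unfold prodW
      rw [Finset.prod_insert hmS, if_pos (Finset.mem_insert_self m Q), runI_succ_mem s n (Finset.mem_insert_self m Q),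
        runI_insert_of_lt Q n (m + 1) _ (Nat.lt_succ_self m)]
      have := prodW_insert_of_not_mem hmS h Q
      unfold prodW at this
      rw [this]
      ring
    rw [Finset.sum_congr rfl hcl, Finset.sum_congr rfl hop, ← Finset.mul_sum, ← Finset.mul_sum]
    ring

/-- **`autoEL` is a pattern expectation**: `autoE start (h 0, …, h (K−1)) = Σ_{Q ⊆ range K} hairW K h Q · pay (run Q)`. [this work] -/
theorem autoEL_eq_sum_hairW (Amax C Cc Kcred lamN lamD : ℕ) (h : ℕ → ℝ) (K : ℕ) :
    autoEL Amax C Cc Kcred lamN lamD FSt.start ((List.range K).map h) =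
      ∑ Q ∈ (range K).powerset, hairW K h Q * (FSt.runI Amax C Cc Q FSt.start 0 K).payL Amax Kcred lamN lamD := by
  rw [List.range_eq_range', autoEL_range', Nat.zero_add, Nat.Ico_zero_eq_range]
  rfl

/-- **`payL(run Q) ≤ flankPay − λ·𝟙[#Q ≤ 2]`** (`Q ⊆ range K`, `K ≤ Kcred`, `5 ≤ Amax`). [this work] -/
theorem payL_run_le {Amax C Cc Kcred lamN lamD : ℕ} (hA5 : 5 ≤ Amax) (hK : K ≤ Kcred) {Q : Finset ℕ} (hQ : Q ⊆ range K) :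
    (FSt.runI Amax C Cc Q FSt.start 0 K).payL Amax Kcred lamN lamD ≤ flankPay K Q - (if Q.card ≤ 2 then (lamN : ℝ) / lamD else 0) := by
  unfold FSt.payL
  have h1 := pay_run_le_flankPay (C := C) (Cc := Cc) hA5 hK hQ
  have hA : (FSt.runI Amax C Cc Q FSt.start 0 K).A = min Q.card Amax := by
    rw [(runInv_runI Amax C Cc Q K).hA, lvl_eq_card_of_subset hQ]
  have hind : ((FSt.runI Amax C Cc Q FSt.start 0 K).A ≤ 2) ↔ Q.card ≤ 2 := by
    rw [hA, Nat.min_def]; split_ifs <;> omega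
  by_cases hc : Q.card ≤ 2
  · rw [if_pos (hind.2 hc), if_pos hc]; linarith
  · rw [if_neg (fun h => hc (hind.1 h)), if_neg hc]; linarith

/-- `Σ_Q hairW K h Q · 𝟙[#Q ≤ 2] = 1 − hairV K h 2 (range K)` (`P(T ≤ 2) = 1 − F`). [this work] -/
theorem sum_hairW_card_le_two (h : ℕ → ℝ) :
    ∑ Q ∈ (range K).powerset, hairW K h Q * (if Q.card ≤ 2 then (1 : ℝ) else 0) = 1 - hairV K h 2 (range K) := by
  unfold hairV
  rw [eq_sub_iff_add_eq, ← Finset.sum_add_distrib]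
  have hone := sum_hairW_eq_one (K := K) h
  conv_rhs => rw [← hone]
  refine Finset.sum_congr rfl fun Q hQ => ?_
  have hQK : Q ∩ range K = Q := Finset.inter_eq_left.2 (Finset.mem_powerset.1 hQ)
  rw [hQK]
  by_cases h2 : Q.card ≤ 2
  · rw [if_pos h2, if_neg (by omega)]; ring
  · rw [if_neg h2, if_pos (by omega)]; ring

/-- **THRESHOLD CERTIFICATE ⇒ `Σ_Q hairW·flankPay − λ(1 − F) ≥ t/(q^K·Lpay)` AT EVERY CERTIFIED WORD.** [this work] -/
theorem sum_hairW_flankPay_sub_ge_of_gameCertT {P : GameSpec} (W : P.WF) {lamN lamD : ℕ} (hlam : lamD ∣ P.Lpay) (hlamD : 0 < lamD)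
    (hA5 : 5 ≤ P.Amax) {NB K : ℕ} (hKc : K ≤ P.Kcred) {Bt : List (ℕ × ℤ)} (hc : P.gameCertT lamN lamD NB K Bt = true) (hK : 2 ≤ K)
    (word : List ℕ) (hw : ∀ i ∈ word, i < P.nL) (hlen : word.length = K) {t : ℤ} (hBt : ((word.map P.wOf).sum, t) ∈ Bt)
    (hNB : (word.map P.wOf).sum ≤ NB) :
    (t : ℝ) ≤ (P.q : ℝ) ^ K * P.Lpay *
      (∑ Q ∈ (range K).powerset, hairW K (fun k => P.gOf (word.getD k 0)) Q * flankPay K Q -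
        (lamN : ℝ) / lamD * (1 - hairV K (fun k => P.gOf (word.getD k 0)) 2 (range K))) := by
  set h : ℕ → ℝ := fun k => P.gOf (word.getD k 0) with hh
  have hmap : word.map P.gOf = (List.range K).map h := by
    apply List.ext_getElem
    · simp [hlen]
    · intro n h1 h2
      simp only [List.getElem_map, List.getElem_range, hh]
      rw [List.getD_eq_getElem]
  have h0 := GameSpec.autoEL_ge_of_gameCertT W hlam hlamD hc hK word hw hlen hBt hNB
  rw [hmap, autoEL_eq_sum_hairW] at h0
  have hpos : (0 : ℝ) < (P.q : ℝ) ^ K * P.Lpay := by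
    have hL : (0 : ℝ) < P.Lpay := by exact_mod_cast W.Lpay_pos
    have hq : (0 : ℝ) < P.q := by exact_mod_cast W.q_pos
    positivity
  have hle : ∑ Q ∈ (range K).powerset, hairW K h Q * (FSt.runI P.Amax P.C P.Cc Q FSt.start 0 K).payL P.Amax P.Kcred lamN lamD ≤
      ∑ Q ∈ (range K).powerset, hairW K h Q * flankPay K Q - (lamN : ℝ) / lamD * (1 - hairV K h 2 (range K)) := by
    rw [← sum_hairW_card_le_two h, Finset.mul_sum, ← Finset.sum_sub_distrib]
    refine Finset.sum_le_sum fun Q hQ => ?_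
    have hQ' : Q ⊆ range K := Finset.mem_powerset.1 hQ
    have hW : 0 ≤ hairW K h Q := hairW_nonneg (fun k _ => gOf_mem_unit W _) Q
    have := mul_le_mul_of_nonneg_left (payL_run_le (C := P.C) (Cc := P.Cc) (lamN := lamN) (lamD := lamD) hA5 hKc hQ') hW
    have e : hairW K h Q * (flankPay K Q - (if Q.card ≤ 2 then (lamN : ℝ) / lamD else 0)) =
        hairW K h Q * flankPay K Q - (lamN : ℝ) / lamD * (hairW K h Q * (if Q.card ≤ 2 then (1 : ℝ) else 0)) := by
      split_ifs <;> ring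
    linarith [e]
  exact h0.trans (mul_le_mul_of_nonneg_left hle hpos.le)

end Summit.CriticalPhenomena.PercolationContinuityZ3.Theorems.HairyCycle

end
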